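import Summits.ValiantsHypothesis.ValiantsHypothesis.Theorems.SymmetroidPencilBasics
import Summits.ValiantsHypothesis.ValiantsHypothesis.Theorems.LacunarySymmetroidMatrixDescartesStubReverse

/-!
# `WeakLifting`, line (B) `tower_graft` — calibration at `m = 3`: the two-sided `3 × 3` word exceeds `2m` ON A GENUINE 3-TOWER

Crux `stmt-ValiantsHypothesis-19561` (`Theses.KPlusLogSqLaw.WeakLifting`), restricted sub-case of the line
`Cruxes/WeakLifting/Lines/tower_graft.lean` (tower supports `IsTower m d : ∀ l < l', m·d l < d l'`).  Companion of
`…TowerGraftTowerTwoSidedWitness` (`T₂₄`: at `m = 2` the two-sided word `X^e • J + ∑ₖ X^{dₖ} • Pₖ`, `Pₖ ⪰ 0`, one symmetric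
pivot letter `J`, reaches `Z₊ = 6 = 3m > 2m` on the 2-tower `(0,1,3,7)`).  This file is the `m = 3` rung of the same
calibration, asked for by line (B)'s critic («next ask is m = 3»): on the genuine 3-TOWER `(0, 1, 4, 13)` (`3·0 < 1`,
`3·1 < 4`, `3·4 < 13`) the `3 × 3` pencil `T(X) = X¹ • J + X⁰ • P₀ + X⁴ • P₄ + X¹³ • P₁₃` with the rank-two PSD letters
`Pₖ = uₖ uₖᵀ + u'ₖ u'ₖᵀ`, `u = ((−126,−29,−137), (33,28,−72), (51,54,−69))`, `u' = ((0,39,65), (0,−1,−1), (0,1,7))` at the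
exponents `(0, 4, 13)` and the INDEFINITE pivot letter `J = [[−395, 1538, −823], [1538, −1310, −8], [−823, −8, −235]]`
(`J₀₀ < 0 < det J`: one positive and two negative eigenvalues) at the exponent `1` (the (1,2)-configuration again) has
`det T` alternating in sign at `1/4 < 3/8 < 1/2 < 3/4 < 1 < 5/4 < 2 < 5 < 8`, hence `Z₊ ≥ 8 > 6 = 2m`
(`eight_le_card_posRoots_T₃`, `not_towerTwoSidedLaw_three`, `exists_tower_twoSided_gt_two_mul_card_three`).  So at
`m = 3`, as at `m = 2`, the tower hypothesis does not rescue a `K`-free law `Z₊ ≤ 2m` for the two-sided word, already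
with four letters.  Found by zero-forcing Levenberg–Marquardt on `3 × 3` letters (det coefficients = mixed discriminants
by polarisation) and integerised at scale 32; compute note `liftp3-m3-tower` of the cell `pub-symmetroid`.  Harmless to
`TowerB` (polynomial counts are absorbed by `2^{C(K + log² m)}`).

[folklore] Elementary; the sign pattern is a `norm_num` certificate at rational points.
-/

-- `Summit.ValiantsHypothesis.ValiantsHypothesis.…` repeats a component by the D-0017 layout
-- (single-conjunct summit), which the `dupNamespace` linter flags; the name is mandated.
set_option linter.dupNamespace false

namespace Summit.ValiantsHypothesis.ValiantsHypothesis.Theorems.KPlusLogSqLaw.TowerGraft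

open Summit.ValiantsHypothesis.ValiantsHypothesis.Theorems.SymmetroidDescartes
  (le_card_posRoots_of_alternating)
open Summit.ValiantsHypothesis.ValiantsHypothesis.Theorems.LacunarySymmetroidMatrixDescartes (StubReverse.eval_det_pencil)
open scoped BigOperators Matrix
open Polynomial

namespace TowerTwoSidedWitnessThree

/-- the vectors `uₖ` (first columns of the Cholesky-type factors) of the PSD letters -/
def u₃ : Fin 3 → Fin 3 → ℝ := ![![-126, -29, -137], ![33, 28, -72], ![51, 54, -69]]

/-- the vectors `u'ₖ` (second columns) of the PSD letters -/
def u'₃ : Fin 3 → Fin 3 → ℝ := ![![0, 39, 65], ![0, -1, -1], ![0, 1, 7]]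

/-- the three rank-two PSD letters `Pₖ = uₖ uₖᵀ + u'ₖ u'ₖᵀ` -/
def P₃ (k : Fin 3) : Matrix (Fin 3) (Fin 3) ℝ :=
  Matrix.vecMulVec (u₃ k) (u₃ k) + Matrix.vecMulVec (u'₃ k) (u'₃ k)

/-- their exponents `(0, 4, 13)` -/
def d₃ : Fin 3 → ℕ := ![0, 4, 13]

/-- the pivot exponent `e = 1` (ONE PSD exponent below it, TWO above) -/
def e₃ : ℕ := 1

/-- the indefinite pivot letter `J` -/
def J₃ : Matrix (Fin 3) (Fin 3) ℝ := !![-395, 1538, -823; 1538, -1310, -8; -823, -8, -235]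

/-- the witness pencil `T(X) = X^1 • J + ∑ₖ X^{dₖ} • Pₖ` on the 3-tower `(0, 1, 4, 13)`, in the currency of
`stub_twoSided` -/
noncomputable def T₃ : Matrix (Fin 3) (Fin 3) ℝ[X] :=
  ((X : ℝ[X]) ^ e₃) • J₃.map Polynomial.C + ∑ k, ((X : ℝ[X]) ^ d₃ k) • (P₃ k).map Polynomial.C

/-- `J` is symmetric -/
theorem J₃_isSymm : J₃.IsSymm := by
  unfold Matrix.IsSymm J₃
  ext i j
  fin_cases i <;> fin_cases j <;> simp

/-- `J` is not positive semidefinite: a negative diagonal entry -/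
theorem J₃_apply_zero_zero_neg : J₃ 0 0 < 0 := by
  simp [J₃]

/-- … and not negative semidefinite: `det J > 0` (so `J` has one positive and two negative eigenvalues) -/
theorem det_J₃_pos : 0 < J₃.det := by
  simp [J₃, Matrix.det_fin_three]
  norm_num

/-- every `Pₖ` is positive semidefinite -/
theorem P₃_posSemidef (k : Fin 3) : (P₃ k).PosSemidef := by
  have h1 := Matrix.posSemidef_vecMulVec_self_star (R := ℝ) (u₃ k)
  have h2 := Matrix.posSemidef_vecMulVec_self_star (R := ℝ) (u'₃ k)
  rw [star_trivial] at h1 h2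
  exact h1.add h2

/-- the witness is two-sided: PSD exponents on both sides of the pivot -/
theorem twoSided₃ : (∃ k, d₃ k < e₃) ∧ (∃ k, e₃ < d₃ k) :=
  ⟨⟨0, by simp [d₃, e₃]⟩, ⟨2, by simp [d₃, e₃]⟩⟩

/-- the support `{e} ∪ {dₖ}` = `(0, 1, 4, 13)` is a genuine 3-TOWER (`3·x < y` for all exponents `x < y`; this is
`TowerGraftLine.IsTower 3` of line (B) for the sorted exponent vector), stated pairwise -/
theorem tower₃ : (∀ k, d₃ k < e₃ → 3 * d₃ k < e₃) ∧ (∀ k, e₃ < d₃ k → 3 * e₃ < d₃ k) ∧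
    (∀ k k', d₃ k < d₃ k' → 3 * d₃ k < d₃ k') := by
  refine ⟨?_, ?_, ?_⟩
  · intro k; fin_cases k <;> simp [d₃, e₃]
  · intro k; fin_cases k <;> simp [d₃, e₃]
  · intro k k'; fin_cases k <;> fin_cases k' <;> simp [d₃]

/-- `det T(t)` in closed form (cofactor expansion of the symmetric `3 × 3` matrix of entry polynomials) -/
theorem eval_det_T₃ (t : ℝ) :
    (T₃.det).eval t =
      (15876 - 395 * t + 1089 * t ^ 4 + 2601 * t ^ 13) *
          ((2362 - 1310 * t + 785 * t ^ 4 + 2917 * t ^ 13) * (22994 - 235 * t + 5185 * t ^ 4 + 4810 * t ^ 13) -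
            (6508 - 8 * t - 2015 * t ^ 4 - 3719 * t ^ 13) ^ 2) -
        (3654 + 1538 * t + 924 * t ^ 4 + 2754 * t ^ 13) *
          ((3654 + 1538 * t + 924 * t ^ 4 + 2754 * t ^ 13) * (22994 - 235 * t + 5185 * t ^ 4 + 4810 * t ^ 13) -
            (6508 - 8 * t - 2015 * t ^ 4 - 3719 * t ^ 13) * (17262 - 823 * t - 2376 * t ^ 4 - 3519 * t ^ 13)) +
        (17262 - 823 * t - 2376 * t ^ 4 - 3519 * t ^ 13) *
          ((3654 + 1538 * t + 924 * t ^ 4 + 2754 * t ^ 13) * (6508 - 8 * t - 2015 * t ^ 4 - 3719 * t ^ 13) -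
            (2362 - 1310 * t + 785 * t ^ 4 + 2917 * t ^ 13) * (17262 - 823 * t - 2376 * t ^ 4 - 3519 * t ^ 13)) := by
  unfold T₃
  rw [StubReverse.eval_det_pencil]
  simp only [Matrix.det_fin_three, Fin.sum_univ_three, Matrix.add_apply, Matrix.smul_apply, P₃, u₃, u'₃, J₃, d₃, e₃,
    Matrix.vecMulVec_apply, Matrix.cons_val_zero, Matrix.cons_val_one, Matrix.cons_val_two, Function.comp_apply,
    Fin.succ_zero_eq_one, Matrix.of_apply, Matrix.cons_val', Matrix.empty_val', Matrix.cons_val_fin_one,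
    Matrix.vecHead, Matrix.vecTail, smul_eq_mul, pow_zero, pow_one, one_mul]
  ring

/-- nine positive test points -/
noncomputable def τ₃ : Fin 9 → ℝ := ![1/4, 3/8, 1/2, 3/4, 1, 5/4, 2, 5, 8]

/-- the test points increase -/
theorem τ₃_strictMono : StrictMono τ₃ := by
  refine Fin.strictMono_iff_lt_succ.2 fun j => ?_
  fin_cases j <;> simp [τ₃] <;> norm_num

/-- the test points are positive -/
theorem τ₃_pos (j : Fin 9) : 0 < τ₃ j := by
  fin_cases j <;> simp [τ₃]

/-- `det T` alternates in sign along the test points (signs `+,−,+,−,+,−,+,−,+`; `norm_num` certificate) -/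
theorem alt₃ (j : Fin 8) :
    (T₃.det).eval (τ₃ j.castSucc) * (T₃.det).eval (τ₃ j.succ) < 0 := by
  fin_cases j <;> simp only [eval_det_T₃, τ₃] <;> simp <;> norm_num

/-- **`Z₊ ≥ 8`** for the two-sided `3 × 3` witness on the 3-tower `(0, 1, 4, 13)`. -/
theorem eight_le_card_posRoots_T₃ :
    8 ≤ (T₃.det.roots.toFinset.filter (fun t => 0 < t)).card :=
  le_card_posRoots_of_alternating _ 8 τ₃ τ₃_strictMono τ₃_pos alt₃

end TowerTwoSidedWitnessThree

open TowerTwoSidedWitnessThree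

/-- **No `K`-free law `≤ 2m` for the two-sided word on 3-towers at `m = 3`.**  It is NOT true that every two-sided
`3 × 3` pencil `X^e • J + ∑ₖ X^{dₖ} • Pₖ` (`J` symmetric, `Pₖ ⪰ 0`, four letters) whose exponent set `{e} ∪ {dₖ}` is a
3-tower has at most `2 · 3` distinct positive zeros of its determinant: the witness `T₃` has at least `8`. -/
theorem not_towerTwoSidedLaw_three : ¬ ∀ (e : ℕ) (d : Fin 3 → ℕ) (J : Matrix (Fin 3) (Fin 3) ℝ)
    (P : Fin 3 → Matrix (Fin 3) (Fin 3) ℝ), J.IsSymm → (∀ k, (P k).PosSemidef) →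
    (∀ k, d k < e → 3 * d k < e) → (∀ k, e < d k → 3 * e < d k) → (∀ k k', d k < d k' → 3 * d k < d k') →
    ((Matrix.det (((Polynomial.X : Polynomial ℝ) ^ e) • J.map Polynomial.C
        + ∑ k, ((Polynomial.X : Polynomial ℝ) ^ d k) • (P k).map Polynomial.C)).roots.toFinset.filter
          (fun t => 0 < t)).card ≤ 2 * 3 := by
  intro h
  have h8 := eight_le_card_posRoots_T₃.trans
    (h e₃ d₃ J₃ P₃ J₃_isSymm P₃_posSemidef tower₃.1 tower₃.2.1 tower₃.2.2)
  omega

/-- The same witness existentially, in the vocabulary of `stub_twoSided` plus the 3-tower condition: a symmetric `J`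
with `J₀₀ < 0 < det J` (indefinite), PSD `Pₖ` on BOTH sides of the pivot, a 3-tower support, and MORE than `2 · card ι`
positive zeros. -/
theorem exists_tower_twoSided_gt_two_mul_card_three :
    ∃ (e : ℕ) (d : Fin 3 → ℕ) (J : Matrix (Fin 3) (Fin 3) ℝ) (P : Fin 3 → Matrix (Fin 3) (Fin 3) ℝ),
      J.IsSymm ∧ J 0 0 < 0 ∧ 0 < J.det ∧ (∀ k, (P k).PosSemidef) ∧ (∃ k, d k < e) ∧ (∃ k, e < d k) ∧
        (∀ k, d k < e → 3 * d k < e) ∧ (∀ k, e < d k → 3 * e < d k) ∧ (∀ k k', d k < d k' → 3 * d k < d k') ∧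
        2 * Fintype.card (Fin 3) <
          ((Matrix.det (((X : ℝ[X]) ^ e) • J.map Polynomial.C
              + ∑ k, ((X : ℝ[X]) ^ d k) • (P k).map Polynomial.C)).roots.toFinset.filter
                (fun t => 0 < t)).card :=
  ⟨e₃, d₃, J₃, P₃, J₃_isSymm, J₃_apply_zero_zero_neg, det_J₃_pos, P₃_posSemidef, twoSided₃.1, twoSided₃.2,
    tower₃.1, tower₃.2.1, tower₃.2.2, by
    have h8 := eight_le_card_posRoots_T₃
    simp only [Fintype.card_fin]
    exact lt_of_lt_of_le (by norm_num) h8⟩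

end Summit.ValiantsHypothesis.ValiantsHypothesis.Theorems.KPlusLogSqLaw.TowerGraft
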